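import Mathlib
import Literature.Computability.AlgebraicComplexity.MultiplicityObstructionsProofs
import Literature.NumberTheory.DiophantineGeometry.SchurWeylPlethysmOrbitWeightsProofs
import Literature.Barriers.ValiantsHypothesis.GCTUsefulModules

/-!
# Seed ceilings: richness ≤ multiplicity ≤ plethysm (crux `ValuativeGCT.ValuativeFlip`, axis "plethysm tables for seedRichness")
(stmt-ValiantsHypothesis-12624; wall-breaker k2/16, prover-wallb-stmt-ValiantsHypothesis-12624-crux-2-0, 2026-08-16.)

The per-side datum of the (dead) line `big-cell-semigroup-floor` — `stub_seedRichness`: a weight `ν`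
carrying `D + 1` ALGEBRAICALLY INDEPENDENT highest-weight vectors of `ℂ[Δ_m(X₀₀^{m-n} per_n)]`, `D ≥ n⁴/4`
— is bounded above by two computable quantities, and this file makes the chain a theorem of the tree:

  `#(algebraically independent HWVs of weight ν) ≤ mult_ν ℂ[Δ_m(f)] ≤ a_ν(δ[m])`  (any form `f` of degree `m ≠ 0`),

* `card_le_orbitMultiplicity_of_algebraicIndependent` — algebraically independent elements are linearly
  independent (Mathlib `AlgebraicIndependent.linearIndependent`) inside the finite-dimensional
  highest-weight space (`finiteDimensional_highestWeightSpace_orbitCoordRep_holds`);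
* `card_le_plethysmCoeff_of_algebraicIndependent` — with BLMW Prop. 4.4.1
  (`orbitMultiplicity_le_plethysmCoeff_holds`);
* `seedDatum_kadishLandsberg` — at the padded permanent the seed weight is `ν = λ*` for a partition
  `λ ⊢ d·m` with `ℓ(λ) ≤ n² + 1` and `λ₁ ≥ d(m-n)` (Kadish–Landsberg / BIP Thm. 4.9, tree
  `exists_presentation_long_row_of_hasHighestWeight`), and `D + 1 ≤ a_λ(d[m])`;
* `seedRichness_forces_rich_plethysm` — the registered signature of `stub_seedRichness` implies, for all
  large `n` and every `m ≥ n`, a Kadish–Landsberg shape whose plethysm coefficient is `≥ n⁴/4 + 1`.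

So the plethysm TABLES `a_λ(d[m])` restricted to Kadish–Landsberg shapes are certified ceilings for seed
richness; the exact tables (kit job j018529, `Cruxes/ValuativeFlip` evidence) give e.g. `d ≥ 10` for a rich
seed at `(n, m) = (3, 3)`, `d ≥ 7` at `(3, 4)`, `d ≥ 6` at `(3, 5)` and `(3, 6)`, and no rich seed at all at
`(2, 2)` (`ℂ[Sym² ℂ⁴]` is multiplicity-free).  Sources: BLMW, SIAM J. Comput. 40 (2011) §4.4, §5.2;
Kadish–Landsberg, Comm. Algebra 42 (2014) Thm. 1.2; BIP, J. AMS 32 (2019) Thm. 4.9; folklore.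
-/

set_option linter.dupNamespace false

namespace Summit.ValiantsHypothesis.ValiantsHypothesis.Theorems.ValuativeFlip

open scoped BigOperators
open Literature.NumberTheory.DiophantineGeometry Literature.Computability.AlgebraicComplexity
open Literature.Computability.Complexity

noncomputable section

/-- **Richness ≤ multiplicity.** In the coordinate ring `ℂ[Δ_m(f)]` of the orbit closure of ANY form
`f` (degree `m ≠ 0`), a finite algebraically independent family of highest-weight vectors of one weight
`χ` has at most `mult_χ ℂ[Δ_m(f)] = orbitMultiplicity ℂ f m χ` members: algebraically independent
elements are linearly independent, and they lie in the highest-weight space, which is finite-dimensional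
because a weight pins the degree. [BLMW 2011 §5.2; folklore] -/
theorem card_le_orbitMultiplicity_of_algebraicIndependent {σ : Type} [Fintype σ] [LinearOrder σ]
    (f : MvPolynomial σ ℂ) {m : ℕ} (hm : m ≠ 0) (χ : Weight σ) {ι : Type} [Fintype ι]
    (F : ι → OrbitCoordRing f m) (hF : ∀ i, F i ∈ highestWeightSpace (orbitCoordRep f m) χ)
    (hind : AlgebraicIndependent ℂ F) :
    Fintype.card ι ≤ orbitMultiplicity ℂ f m χ := by
  set W := highestWeightSpace (orbitCoordRep f m) χ with hW
  haveI : FiniteDimensional ℂ ↥W :=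
    finiteDimensional_highestWeightSpace_orbitCoordRep_holds (k := ℂ) f hm χ
  have hlin : LinearIndependent ℂ F := hind.linearIndependent
  let F' : ι → ↥W := fun i => ⟨F i, hF i⟩
  have hcomp : (W.subtype : ↥W →ₗ[ℂ] OrbitCoordRing f m) ∘ F' = F := by
    funext i
    rfl
  have hlin' : LinearIndependent ℂ F' := by
    apply LinearIndependent.of_comp W.subtype
    rw [hcomp]
    exact hlin
  have h := hlin'.fintype_card_le_finrank
  simpa [orbitMultiplicity, hwMultiplicity, hW] using h

/-- The `Fin (D + 1)`-indexed form used by the crux's stubs: `D + 1` algebraically independent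
highest-weight vectors of weight `χ` force `D + 1 ≤ mult_χ ℂ[Δ_m(f)]` — the `k = 1` case of the landed
semigroup floor `C(k + D, D) ≤ mult(k • χ)` (`semigroupFloor`, p98674), here directly. [folklore] -/
theorem succ_le_orbitMultiplicity_of_algebraicIndependent {σ : Type} [Fintype σ] [LinearOrder σ]
    (f : MvPolynomial σ ℂ) {m : ℕ} (hm : m ≠ 0) (χ : Weight σ) (D : ℕ)
    (F : Fin (D + 1) → OrbitCoordRing f m) (hF : ∀ i, F i ∈ highestWeightSpace (orbitCoordRep f m) χ)
    (hind : AlgebraicIndependent ℂ F) :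
    D + 1 ≤ orbitMultiplicity ℂ f m χ := by
  simpa using card_le_orbitMultiplicity_of_algebraicIndependent f hm χ F hF hind

/-- **Richness ≤ plethysm.** For a FORM `f` of degree `m ≠ 0`, a finite algebraically independent family
of highest-weight vectors of weight `χ` in `ℂ[Δ_m(f)]` has at most `a_χ = plethysmCoeff ℂ σ m χ`
members (the multiplicity of `χ` in `ℂ[Sym^m ℂ^σ]`): `card ≤ mult_χ ℂ[Δ_m(f)]`
(`card_le_orbitMultiplicity_of_algebraicIndependent`) and `mult_χ ℂ[Δ_m(f)] ≤ a_χ` (BLMW Prop. 4.4.1,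
`orbitMultiplicity_le_plethysmCoeff_holds`).  This is the sense in which plethysm TABLES bound seed
richness. [BLMW 2011 Prop. 4.4.1, §5.2] -/
theorem card_le_plethysmCoeff_of_algebraicIndependent {σ : Type} [Fintype σ] [LinearOrder σ]
    (f : MvPolynomial σ ℂ) {m : ℕ} (hm : m ≠ 0) (hf : f.IsHomogeneous m) (χ : Weight σ)
    {ι : Type} [Fintype ι] (F : ι → OrbitCoordRing f m)
    (hF : ∀ i, F i ∈ highestWeightSpace (orbitCoordRep f m) χ) (hind : AlgebraicIndependent ℂ F) :
    Fintype.card ι ≤ plethysmCoeff ℂ σ m χ :=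
  (card_le_orbitMultiplicity_of_algebraicIndependent f hm χ F hF hind).trans
    (orbitMultiplicity_le_plethysmCoeff_holds (k := ℂ) f hm hf χ)

/-- A nonempty algebraically independent family of highest-weight vectors of weight `χ` makes `χ` OCCUR
(`HasHighestWeight`): its members are nonzero (an algebraically independent family over a nontrivial ring
has no zero member, as it is linearly independent). [folklore] -/
theorem hasHighestWeight_of_algebraicIndependent {σ : Type} [Fintype σ] [LinearOrder σ]
    (f : MvPolynomial σ ℂ) (m : ℕ) (χ : Weight σ) {ι : Type} (i₀ : ι)
    (F : ι → OrbitCoordRing f m) (hF : ∀ i, F i ∈ highestWeightSpace (orbitCoordRep f m) χ)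
    (hind : AlgebraicIndependent ℂ F) :
    HasHighestWeight (orbitCoordRep f m) χ := by
  rw [hasHighestWeight_iff_exists]
  exact ⟨F i₀, hind.linearIndependent.ne_zero i₀, hF i₀⟩

/-- **Seed data live on Kadish–Landsberg shapes, below the plethysm table.**  At the padded permanent
`X₀₀^{m-n} per_n` (`n ≤ m`, `m ≠ 0`): if a weight `ν` carries `D + 1` algebraically independent
highest-weight vectors of `ℂ[Δ_m(X₀₀^{m-n} per_n)]`, then `ν = λ*` (`partitionWeightLex m λ`) for a
partition `λ ⊢ d·m` with at most `n² + 1` parts and first part `λ₁ ≥ d(m - n)` (BIP Thm. 4.9(1) and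
Kadish–Landsberg, tree `exists_presentation_long_row_of_hasHighestWeight`), and
`D + 1 ≤ mult_{λ*} ℂ[Δ_m(X₀₀^{m-n} per_n)] ≤ a_λ(d[m])`.  So the richness of any seed weight of degree `d`
is at most `R(n, m, d) := max {a_λ(d[m]) : λ ⊢ dm Kadish–Landsberg}` — the quantity tabulated by the axis's
kit job. [Kadish–Landsberg 2014 Thm. 1.2; BIP 2019 Thm. 4.9; BLMW 2011 Prop. 4.4.1] -/
theorem seedDatum_kadishLandsberg {n m : ℕ} [NeZero m] (hnm : n ≤ m) (ν : Weight (MatIdx m)) (D : ℕ)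
    (F : Fin (D + 1) → OrbitCoordRing (paddedPerFormLex ℂ n m) m)
    (hF : ∀ i, F i ∈ highestWeightSpace (orbitCoordRep (paddedPerFormLex ℂ n m) m) ν)
    (hind : AlgebraicIndependent ℂ F) :
    ∃ (d : ℕ) (lam : Nat.Partition (d * m)), lam.parts.card ≤ n ^ 2 + 1 ∧ d * (m - n) ≤ lam.parts.sup ∧
      ν = partitionWeightLex m lam ∧
      D + 1 ≤ orbitMultiplicity ℂ (paddedPerFormLex ℂ n m) m (partitionWeightLex m lam) ∧
      orbitMultiplicity ℂ (paddedPerFormLex ℂ n m) m (partitionWeightLex m lam) ≤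
        plethysmCoeff ℂ (MatIdx m) m (partitionWeightLex m lam) := by
  have hm : m ≠ 0 := NeZero.ne m
  have hocc : HasHighestWeight (paddedPerOrbitRep ℂ n m) ν :=
    hasHighestWeight_of_algebraicIndependent (paddedPerFormLex ℂ n m) m ν (0 : Fin (D + 1)) F hF hind
  obtain ⟨d, lam, hcard, hrow, hν⟩ :=
    Literature.Barriers.ValiantsHypothesis.exists_presentation_long_row_of_hasHighestWeight hnm hocc
  subst hν
  refine ⟨d, lam, hcard, hrow, rfl, ?_, ?_⟩
  · exact succ_le_orbitMultiplicity_of_algebraicIndependent _ hm _ D F hF hind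
  · exact orbitMultiplicity_le_plethysmCoeff_holds (k := ℂ) _ hm (paddedPerFormLex_isHomogeneous ℂ hnm) _

/-- **`stub_seedRichness` forces rich plethysm on Kadish–Landsberg shapes.**  The registered signature of
the (expired) stub `stub_seedRichness` of line `big-cell-semigroup-floor` — for all large `n` and every
`m ≥ n`, a weight with `D + 1 > n⁴/4` algebraically independent highest-weight vectors in
`ℂ[Δ_m(X₀₀^{m-n} per_n)]` — implies: for all large `n` and every `m ≥ n` there is a Kadish–Landsberg shape
`λ ⊢ d·m` (`ℓ(λ) ≤ n² + 1`, `λ₁ ≥ d(m-n)`) with `n⁴/4 + 1 ≤ mult_{λ*} ℂ[Δ_m(X₀₀^{m-n} per_n)] ≤ a_λ(d[m])`.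
This is the certified reading of the axis's plethysm tables: at `(n, m, d)` a rich seed needs
`R(n, m, d) ≥ n⁴/4 + 1` (e.g. `d ≥ 10` at `(3,3)`, `d ≥ 7` at `(3,4)`, `d ≥ 6` at `(3,5)`; kit j018529).
[this file; Kadish–Landsberg 2014; BLMW 2011 Prop. 4.4.1] -/
theorem seedRichness_forces_rich_plethysm :
    (∃ n₁ : ℕ, ∀ n ≥ n₁, ∀ (m : ℕ) [NeZero m], n ≤ m →
      ∃ (ν : Weight (MatIdx m)) (D : ℕ) (F : Fin (D + 1) → OrbitCoordRing (paddedPerFormLex ℂ n m) m),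
        n ^ 4 / 4 ≤ D ∧
        (∀ i, F i ∈ highestWeightSpace (orbitCoordRep (paddedPerFormLex ℂ n m) m) ν) ∧
        AlgebraicIndependent ℂ F) →
    ∃ n₁ : ℕ, ∀ n ≥ n₁, ∀ (m : ℕ) [NeZero m], n ≤ m →
      ∃ (d : ℕ) (lam : Nat.Partition (d * m)), lam.parts.card ≤ n ^ 2 + 1 ∧ d * (m - n) ≤ lam.parts.sup ∧
        n ^ 4 / 4 + 1 ≤ orbitMultiplicity ℂ (paddedPerFormLex ℂ n m) m (partitionWeightLex m lam) ∧
        orbitMultiplicity ℂ (paddedPerFormLex ℂ n m) m (partitionWeightLex m lam) ≤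
          plethysmCoeff ℂ (MatIdx m) m (partitionWeightLex m lam) := by
  intro hSeed
  obtain ⟨n₁, h⟩ := hSeed
  refine ⟨n₁, fun n hn m _ hnm => ?_⟩
  obtain ⟨ν, D, F, hD, hF, hind⟩ := h n hn m hnm
  obtain ⟨d, lam, hcard, hrow, -, hmult, hpleth⟩ := seedDatum_kadishLandsberg hnm ν D F hF hind
  exact ⟨d, lam, hcard, hrow, le_trans (by omega) hmult, hpleth⟩

end

end Summit.ValiantsHypothesis.ValiantsHypothesis.Theorems.ValuativeFlip
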